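import Summits.QuantumFields.YangMills.Theorems.FlatTubeReductionTransportExponentKept
import Summits.QuantumFields.YangMills.Theorems.FlatTubeReductionMomentTransport
import Summits.QuantumFields.YangMills.Theorems.LuscherReductionTwistedTraceScalingBOCoreTransfer
import HarnessLib

/-!
# (C2-moments, step (iii)) THE CORE TRANSFER DEFECT WITH MOMENTS: the colour integral of the core fibre transfer is `c₁·P(x')·K̃₁(u',u)/K₁(1,1)` up to a RELATIVE defect
# `2(1+η_c)·Q(s') + η_c` whose slow coefficients are POINTWISE in `(u', u)` and whose fibre/gauge sizes enter only through CENTRAL reweighted-transfer ratios `w(s')`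
# (route `FlatTubeReduction`, crux K1 `NearFlatRatioLaw` stmt-QuantumFields-24720, line «ratepack_v2» skeleton v6, stub `stub_hODpot_A`; seat `ym-line-ftr-p1` g18;
# memo `Cruxes/NearFlatRatioLaw/Lines/ratepack-v6-port-g17.md` §§5–7 and the g18 memo `Lines/ratepack-v7-moments-g18.md`; R2b1 RECORD rung — no summit statement is proved here)

WHY.  Lane A's `…BOCoreTransferInner.colour_fpFibreTransfer_two_sided_inner` sandwiches `I = ∫_c fpFibreTransfer β Ω W (c⁻¹(oT u' v')c) u dc` between
`e^{∓η}(1 ∓ η_c)·c₁P(x')·ρ̄(u',u)` with ONE number `η` built from SUP radii; at the rate twin's scales `η ∋ β·δ·T² ≍ β^{-1/6}ℓ⁴` (memo §5).  Here the exponent is kept as a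
polynomial in the actual size (`…TransportExponentKept.abs_transportExponent_le_poly`), the fibre transfer is transported ADDITIVELY (`…MomentTransport.fpFibreTransfer_sub_central_le_moments`),
and the reweighted CENTRAL transfers are consumed as RATIOS `T[Ω‖·‖^{2k},W](x'') ≤ w_a k (‖x''‖²)·T[Ω,W](x'')`, `T[Ω,W·G^j](x'') ≤ w_b j (‖x''‖²)·T[Ω,W](x'')` on the inner core
(hypotheses `hwa`, `hwb` — the analytic input of the (C2-moments) route, to be supplied by the layer-cake moment machine; memo v7 §3), together with lane A's central quasimode `hC1`.
RESULT ★★★ `colour_fpFibreTransfer_defect_le_moments`: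
`|I − c₁P(x')ρ̄| ≤ (2(1+η_c)·Q + η_c)·c₁P(x')ρ̄`, `Q = (c₀ + c₁'s' + 3c₂'s'²) + c₁'(w_a 1 s' + w_b 1 s') + 3c₂'(w_a 2 s' + w_b 2 s')`, `s' = ‖x'‖²`,
for ANY majorants `c₀ ≥ 216β(δ+δu)δΓ`, `c₁' ≥ K_L(β((δ+δu) + δ + (δ+δu)² + δ² + √σ) + √β/2)`, `c₂' ≥ K_L(β + β√β/2)` (`K_L = 3·10⁸(|E| + |P×3| + |P|)`) with
`c₀ + c₁'S₀ + c₂'S₀² ≤ 1`, `S₀ = R_in² + R² + |Λ|T²` — the slow window `δ` (output), `δu` (input) and action ceiling `σ` are free parameters, to be taken POINTWISE downstream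
(`δ = orbitDist u'`, `δu = orbitDist u`, `σ = 12L³(δ⁴ + δu⁴)`): the first-order part `β(2δ + δu)·(…)` is the potential term of `stub_hODpot_A`.
* §1 `sqrt_mul_poly_le` — `β·S√S ≤ (√β·S + β√β·S²)/2`; `abs_transportExponent_le_quad` — the exponent as `c₀ + c₁'S + c₂'S²`;
* §2 ★★★ `colour_fpFibreTransfer_defect_le_moments`.
HONEST FRAMING: bookkeeping for a stub of the CONDITIONAL reduction route R2b1 (rate twin); the ratios `w_a, w_b` ((C2-moments) step (iv), layer cake), the (C1)-rate, the `L²`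
assembly with the potential, (B-ST) and the crux remain OPEN; femto rung R2b1 (RECORD label); not infinite volume, not a mass gap, not Clay.  No defs, no named facts, no `sorry`.
-/

set_option autoImplicit false

noncomputable section

open MeasureTheory Filter Topology Real
open scoped BigOperators
open Literature.MathematicalPhysics.QuantumFieldTheory
open Literature.MathematicalPhysics.QuantumLattice

namespace Summit.QuantumFields.YangMills.Theorems.FemtoTransferGap.TwoLattice.ConstTube

open Summit.QuantumFields.YangMills.Theorems.FemtoTransferGap
open Summit.QuantumFields.YangMills.Theorems.FemtoTransferGap.TwoLattice
open Summit.QuantumFields.YangMills.Theorems.FemtoTransferGap.TwoLattice.Avg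
open Summit.QuantumFields.YangMills.Theorems.FemtoTransferGap.TwoLattice.Stiff (LinkSpace)
open Summit.QuantumFields.YangMills.Theorems.TwistedTraceScaling.Negative.R33 (gaugeTransform_const_orthoTube)

variable {L : ℕ} [NeZero L]

/-! ## §1 The exponent as a quadratic polynomial in the kept size -/

/-- `β·S√S ≤ (√β·S + β√β·S²)/2` (`β, S ≥ 0`; AM–GM `2√(βS) ≤ 1 + βS`). [folklore] -/
theorem sqrt_mul_poly_le {β S : ℝ} (hβ : 0 ≤ β) (hS : 0 ≤ S) : β * (S * Real.sqrt S) ≤ (Real.sqrt β * S + β * Real.sqrt β * S ^ 2) / 2 := by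
  obtain ⟨q, hq, rfl⟩ : ∃ q : ℝ, 0 ≤ q ∧ β = q * q := ⟨Real.sqrt β, Real.sqrt_nonneg _, (Real.mul_self_sqrt hβ).symm⟩
  obtain ⟨r, hr, rfl⟩ : ∃ r : ℝ, 0 ≤ r ∧ S = r * r := ⟨Real.sqrt S, Real.sqrt_nonneg _, (Real.mul_self_sqrt hS).symm⟩
  rw [Real.sqrt_mul_self hq, Real.sqrt_mul_self hr]
  have h := mul_nonneg (mul_nonneg hq (mul_nonneg hr hr)) (sq_nonneg (1 - q * r))
  nlinarith [h]

/-- ★ **The transport exponent as `c₀ + c₁'S + c₂'S²`.**  Under the hypotheses of `abs_transportExponent_le_poly` and for any majorants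
`c₀ ≥ 216βαδΓ`, `c₁' ≥ K_L(β(α + δ + α² + δ² + √σ) + √β/2)`, `c₂' ≥ K_L(β + β√β/2)`:
`|offX + diagX| ≤ c₀ + c₁'S + c₂'S²`. [cite: Luscher1983, §3] -/
theorem abs_transportExponent_le_quad {β : ℝ} (hβ1 : 1 ≤ β) (u' u : GaugeConfig 3 1 SU2) {v' v : Edge 3 L → Fin 3 → ℝ} (hv' : v' ∈ capBalancedSet L)
    (hv : v ∈ capBalancedSet L) {g : Site 3 L → SU2} {δ α Γ σ S c₀ c₁ c₂ : ℝ}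
    (hδ : ∀ k : Fin 3, ‖su2Quat (u' (0, k)) - 1‖ ≤ δ) (hδ1 : δ ≤ 1 / 2) (hα : ∀ k : Fin 3, ‖su2Quat (u' (0, k)) - su2Quat (u (0, k))‖ ≤ α) (hα1 : α ≤ 1)
    (hσ : σ < 2) (hS' : (L : ℝ) ^ 3 * wilsonAction su2Rep u' ≤ σ) (hS : (L : ℝ) ^ 3 * wilsonAction su2Rep u ≤ σ) (hΓ : ‖∑ x, vecPart (g x)‖ ≤ Γ)
    (hSge : ‖linkEmbed L v'‖ ^ 2 + ‖linkEmbed L v‖ ^ 2 + ∑ x, ‖su2Quat (g x) - 1‖ ^ 2 ≤ S) (hS900 : S ≤ 1 / 900)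
    (hc₀ : 216 * β * α * δ * Γ ≤ c₀)
    (hc₁ : 300000000 * ((Fintype.card (Edge 3 L) : ℝ) + (Fintype.card (Plaquette 3 L × Fin 3) : ℝ) + (Fintype.card (Plaquette 3 L) : ℝ)) *
      (β * (α + δ + α ^ 2 + δ ^ 2 + Real.sqrt σ) + Real.sqrt β / 2) ≤ c₁)
    (hc₂ : 300000000 * ((Fintype.card (Edge 3 L) : ℝ) + (Fintype.card (Plaquette 3 L × Fin 3) : ℝ) + (Fintype.card (Plaquette 3 L) : ℝ)) * (β + β * Real.sqrt β / 2) ≤ c₂) :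
    |offX L β u' u v' v g + diagX L β u' v' v g| ≤ c₀ + c₁ * S + c₂ * S ^ 2 := by
  have hβ : 0 ≤ β := by linarith
  have hS0 : 0 ≤ S := by
    have hn3 : 0 ≤ ∑ x, ‖su2Quat (g x) - 1‖ ^ 2 := Finset.sum_nonneg fun _ _ => sq_nonneg _
    nlinarith [sq_nonneg ‖linkEmbed L v'‖, sq_nonneg ‖linkEmbed L v‖]
  have h := abs_transportExponent_le_poly hβ1 u' u hv' hv hδ hδ1 hα hα1 hσ hS' hS hΓ hSge hS900
  set K : ℝ := 300000000 * ((Fintype.card (Edge 3 L) : ℝ) + (Fintype.card (Plaquette 3 L × Fin 3) : ℝ) + (Fintype.card (Plaquette 3 L) : ℝ)) with hK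
  have hK0 : 0 ≤ K := by rw [hK]; positivity
  have hδ0 : 0 ≤ δ := (norm_nonneg _).trans (hδ 0)
  have hα0 : 0 ≤ α := (norm_nonneg _).trans (hα 0)
  have hΔ0 : 0 ≤ β * (α + δ + α ^ 2 + δ ^ 2 + Real.sqrt σ) := by have := Real.sqrt_nonneg σ; positivity
  have h3 := sqrt_mul_poly_le hβ hS0
  have hS2 : 0 ≤ S ^ 2 := sq_nonneg _
  -- `K(βΔS + β(S√S + S²)) ≤ K(βΔ + √β/2)S + K(β + β√β/2)S²`
  have hmain : K * (β * (α + δ + α ^ 2 + δ ^ 2 + Real.sqrt σ) * S + β * (S * Real.sqrt S + S ^ 2)) ≤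
      K * (β * (α + δ + α ^ 2 + δ ^ 2 + Real.sqrt σ) + Real.sqrt β / 2) * S + K * (β + β * Real.sqrt β / 2) * S ^ 2 := by
    have e : K * (β * (α + δ + α ^ 2 + δ ^ 2 + Real.sqrt σ) + Real.sqrt β / 2) * S + K * (β + β * Real.sqrt β / 2) * S ^ 2 -
        K * (β * (α + δ + α ^ 2 + δ ^ 2 + Real.sqrt σ) * S + β * (S * Real.sqrt S + S ^ 2)) =
        K * ((Real.sqrt β * S + β * Real.sqrt β * S ^ 2) / 2 - β * (S * Real.sqrt S)) := by ring
    nlinarith [mul_nonneg hK0 (sub_nonneg.mpr h3), e]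
  have hc₁S := mul_le_mul_of_nonneg_right hc₁ hS0
  have hc₂S := mul_le_mul_of_nonneg_right hc₂ hS2
  linarith [h, hmain, hc₁S, hc₂S, hc₀]

/-! ## §2 ★★★ The core transfer defect with moments -/

/-- ★★★ **THE CORE TRANSFER DEFECT WITH MOMENTS** (see the module docstring).  Data: `Ω ≥ 0` bounded measurable, cap-supported with `‖x‖ ≤ R` on its support; `W ≥ 0` bounded
measurable with `‖q(g_x) − 1‖ ≤ T`, `‖Σ g⃗‖ ≤ Γ` on its support; a colour-blind `P ≥ 0` with the central quasimode `|T[Ω,W](x'') − c_q P(x'')| ≤ η_c·c_q P(x'')` on the inner core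
`‖x''‖ ≤ R_in` (components `≤ T_c`, `R_in ≤ T_c`); reweighted-transfer ratios `w_a k`, `w_b j` (`k, j ∈ {1,2}`) on the inner core; output slow point `u'` (`‖q(u'_k) − 1‖ ≤ δ ≤ 1/2`),
input slow point `u` (`‖q(u_k) − 1‖ ≤ δu`, `δ + δu ≤ 1`), one-site actions `≤ σ/L³` (`σ < 2`), `β ≥ 1`; majorants `c₀, c₁', c₂'` as in `abs_transportExponent_le_quad` (with
`α = δ + δu`) with `c₀ + c₁'S₀ + c₂'S₀² ≤ 1`, `S₀ = R_in² + R² + |Λ|T² ≤ 1/900`. [cite: Luscher1983, §3] -/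
theorem colour_fpFibreTransfer_defect_le_moments {β : ℝ} (hβ1 : 1 ≤ β) {Ω : LinkSpace L → ℝ} (hΩm : Measurable Ω) {CΩ : ℝ} (hCΩ : ∀ x, |Ω x| ≤ CΩ) (hΩ0 : ∀ x, 0 ≤ Ω x)
    {W : (Site 3 L → SU2) → ℝ} (hW : Measurable W) {CW : ℝ} (hCW : ∀ g, |W g| ≤ CW) (hW0 : ∀ g, 0 ≤ W g)
    {δ δu T Tc R Rin Γ σ c₀ c₁ c₂ : ℝ} (hδ1 : δ ≤ 1 / 2) (hα1 : δ + δu ≤ 1) (hσ : σ < 2) (hRinT : Rin ≤ Tc)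
    (hΩt : ∀ v : Edge 3 L → Fin 3 → ℝ, Ω (linkEmbed L v) ≠ 0 → v ∈ capBalancedSet L ∧ ‖linkEmbed L v‖ ≤ R)
    (hWc : ∀ g : Site 3 L → SU2, W g ≠ 0 → (∀ x, ‖su2Quat (g x) - 1‖ ≤ T) ∧ ‖∑ x, vecPart (g x)‖ ≤ Γ)
    {P : LinkSpace L → ℝ} (hPinv : ∀ (g : SU2) (x : LinkSpace L), P (adL L g x) = P x) {cq ηc : ℝ} (hcq : 0 ≤ cq) (hP0 : ∀ x, 0 ≤ P x)
    (hC1 : ∀ v'' : Edge 3 L → Fin 3 → ℝ, v'' ∈ capBalancedSet L → (∀ (e : Edge 3 L) (a : Fin 3), |v'' e a| ≤ Tc) → ‖linkEmbed L v''‖ ≤ Rin →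
      |fpFibreTransfer L β Ω W (orthoTube L 1 v'') 1 - cq * P (linkEmbed L v'')| ≤ ηc * (cq * P (linkEmbed L v'')))
    {wa wb : ℕ → ℝ → ℝ} (hwa0 : ∀ k s, 0 ≤ wa k s) (hwb0 : ∀ k s, 0 ≤ wb k s)
    (hwa : ∀ k : ℕ, k = 1 ∨ k = 2 → ∀ v'' : Edge 3 L → Fin 3 → ℝ, v'' ∈ capBalancedSet L → ‖linkEmbed L v''‖ ≤ Rin →
      fpFibreTransfer L β (fun x => Ω x * (‖x‖ ^ 2) ^ k) W (orthoTube L 1 v'') 1 ≤ wa k (‖linkEmbed L v''‖ ^ 2) * fpFibreTransfer L β Ω W (orthoTube L 1 v'') 1)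
    (hwb : ∀ j : ℕ, j = 1 ∨ j = 2 → ∀ v'' : Edge 3 L → Fin 3 → ℝ, v'' ∈ capBalancedSet L → ‖linkEmbed L v''‖ ≤ Rin →
      fpFibreTransfer L β Ω (fun g => W g * (∑ x, ‖su2Quat (g x) - 1‖ ^ 2) ^ j) (orthoTube L 1 v'') 1 ≤ wb j (‖linkEmbed L v''‖ ^ 2) * fpFibreTransfer L β Ω W (orthoTube L 1 v'') 1)
    (hS900 : Rin ^ 2 + R ^ 2 + (Fintype.card (Site 3 L) : ℝ) * T ^ 2 ≤ 1 / 900)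
    (hc₀ : 216 * β * (δ + δu) * δ * Γ ≤ c₀)
    (hc₁ : 300000000 * ((Fintype.card (Edge 3 L) : ℝ) + (Fintype.card (Plaquette 3 L × Fin 3) : ℝ) + (Fintype.card (Plaquette 3 L) : ℝ)) *
      (β * ((δ + δu) + δ + (δ + δu) ^ 2 + δ ^ 2 + Real.sqrt σ) + Real.sqrt β / 2) ≤ c₁)
    (hc₂ : 300000000 * ((Fintype.card (Edge 3 L) : ℝ) + (Fintype.card (Plaquette 3 L × Fin 3) : ℝ) + (Fintype.card (Plaquette 3 L) : ℝ)) * (β + β * Real.sqrt β / 2) ≤ c₂)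
    (hc₀0 : 0 ≤ c₀) (hH1 : c₀ + c₁ * (Rin ^ 2 + R ^ 2 + (Fintype.card (Site 3 L) : ℝ) * T ^ 2) + c₂ * (Rin ^ 2 + R ^ 2 + (Fintype.card (Site 3 L) : ℝ) * T ^ 2) ^ 2 ≤ 1)
    (u' u : GaugeConfig 3 1 SU2) (hu' : ∀ k : Fin 3, ‖su2Quat (u' (0, k)) - 1‖ ≤ δ) (hS' : (L : ℝ) ^ 3 * wilsonAction su2Rep u' ≤ σ)
    (hu : ∀ k : Fin 3, ‖su2Quat (u (0, k)) - 1‖ ≤ δu) (hS : (L : ℝ) ^ 3 * wilsonAction su2Rep u ≤ σ)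
    {v' : Edge 3 L → Fin 3 → ℝ} (hv' : v' ∈ capBalancedSet L) (hx' : ‖linkEmbed L v'‖ ≤ Rin) :
    |∫ c, fpFibreTransfer L β Ω W (gaugeTransform (fun _ : Site 3 L => c⁻¹) (orthoTube L u' v')) u ∂haarProbability SU2 -
        cq * P (linkEmbed L v') * (avgKernel ((L : ℝ) ^ 3 * β) u' u / transferKernel su2Rep ((L : ℝ) ^ 3 * β) (1 : GaugeConfig 3 1 SU2) 1)| ≤
      (2 * (1 + ηc) * ((c₀ + c₁ * ‖linkEmbed L v'‖ ^ 2 + 3 * c₂ * (‖linkEmbed L v'‖ ^ 2) ^ 2) +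
            c₁ * (wa 1 (‖linkEmbed L v'‖ ^ 2) + wb 1 (‖linkEmbed L v'‖ ^ 2)) + 3 * c₂ * (wa 2 (‖linkEmbed L v'‖ ^ 2) + wb 2 (‖linkEmbed L v'‖ ^ 2))) + ηc) *
        (cq * P (linkEmbed L v') * (avgKernel ((L : ℝ) ^ 3 * β) u' u / transferKernel su2Rep ((L : ℝ) ^ 3 * β) (1 : GaugeConfig 3 1 SU2) 1)) := by
  haveI : SecondCountableTopology SU2 := secondCountableTopology_su2
  set B : ℝ := (L : ℝ) ^ 3 * β with hB
  have hβ : 0 ≤ β := by linarith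
  set s' : ℝ := ‖linkEmbed L v'‖ ^ 2 with hs'
  set Q : ℝ := (c₀ + c₁ * s' + 3 * c₂ * s' ^ 2) + c₁ * (wa 1 s' + wb 1 s') + 3 * c₂ * (wa 2 s' + wb 2 s') with hQ
  -- signs of the coefficients
  have hδ0 : 0 ≤ δ := (norm_nonneg _).trans (hu' 0)
  have hδu0 : 0 ≤ δu := (norm_nonneg _).trans (hu 0)
  have hK0 : (0 : ℝ) ≤ 300000000 * ((Fintype.card (Edge 3 L) : ℝ) + (Fintype.card (Plaquette 3 L × Fin 3) : ℝ) + (Fintype.card (Plaquette 3 L) : ℝ)) := by positivity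
  have hc₁0 : 0 ≤ c₁ := le_trans (mul_nonneg hK0 (by have := Real.sqrt_nonneg σ; have := Real.sqrt_nonneg β; positivity)) hc₁
  have hc₂0 : 0 ≤ c₂ := le_trans (mul_nonneg hK0 (by have := Real.sqrt_nonneg β; positivity)) hc₂
  have hs'0 : 0 ≤ s' := sq_nonneg _
  have hQ0 : 0 ≤ Q := by
    rw [hQ]; have := hwa0 1 s'; have := hwa0 2 s'; have := hwb0 1 s'; have := hwb0 2 s'; positivity
  have hK1 : 0 < transferKernel su2Rep B (1 : GaugeConfig 3 1 SU2) 1 := transferKernel_pos _ _ _ _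
  -- the slow ratio `ρ(c) = K₁(c⁻¹u'c, u)/K₁(1,1)`
  set ρ : SU2 → ℝ := fun c => transferKernel su2Rep B (gaugeTransform (fun _ : Site 3 1 => c⁻¹) u') u / transferKernel su2Rep B (1 : GaugeConfig 3 1 SU2) 1 with hρ
  obtain ⟨M1, hM1⟩ := exists_transferKernel_le su2Rep continuous_su2Rep B (L := 1)
  have hρm : Measurable ρ := by
    have hK : Measurable fun p : GaugeConfig 3 1 SU2 × GaugeConfig 3 1 SU2 => transferKernel su2Rep B p.1 p.2 :=
      (continuous_transferKernel su2Rep continuous_su2Rep B).measurable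
    have hc : Measurable fun c : SU2 => gaugeTransform (fun _ : Site 3 1 => c⁻¹) u' := by
      have hcu : Measurable fun _ : SU2 => u' := measurable_const
      have h := (measurable_constGaugeAction (L := 1)).comp (hcu.prodMk measurable_inv)
      simpa only [Function.comp_def] using h
    have hu0 : Measurable fun _ : SU2 => u := measurable_const
    have h := hK.comp (hc.prodMk hu0)
    exact (by simpa only [Function.comp_def] using h : Measurable fun c : SU2 => transferKernel su2Rep B (gaugeTransform (fun _ : Site 3 1 => c⁻¹) u') u).div_const _
  have hρ0 : ∀ c, 0 ≤ ρ c := fun c => div_nonneg (transferKernel_pos _ _ _ _).le hK1.le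
  have hρb : ∀ c, |ρ c| ≤ M1 / transferKernel su2Rep B (1 : GaugeConfig 3 1 SU2) 1 := fun c => by
    rw [abs_of_nonneg (hρ0 c)]; exact div_le_div_of_nonneg_right (hM1 _ _) hK1.le
  have hρint : Integrable ρ (haarProbability SU2) := integrable_of_measurable_abs_le _ hρm hρb
  have hρI : ∫ c, ρ c ∂haarProbability SU2 = avgKernel B u' u / transferKernel su2Rep B (1 : GaugeConfig 3 1 SU2) 1 := by
    rw [hρ, integral_div, ← avgKernel_one_eq_integral_conj]
  -- the colour integrand
  set F : SU2 → ℝ := fun c => fpFibreTransfer L β Ω W (gaugeTransform (fun _ : Site 3 L => c⁻¹) (orthoTube L u' v')) u with hF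
  have hFm : Measurable F := measurable_fpFibreTransfer_conj β hΩm hW _ u
  obtain ⟨BF, hBF⟩ := abs_fpFibreTransfer_le (L := L) β hCΩ hCW u
  have hFint : Integrable F (haarProbability SU2) := integrable_of_measurable_abs_le _ hFm fun c => hBF _
  -- support radii: `S ≤ S₀ ≤ 1/900` on the supports, for any output fibre point of norm `≤ Rin`
  have hSsupp : ∀ (v'' v : Edge 3 L → Fin 3 → ℝ) (g : Site 3 L → SU2), ‖linkEmbed L v''‖ ≤ Rin → Ω (linkEmbed L v) ≠ 0 → W g ≠ 0 →
      ‖linkEmbed L v''‖ ^ 2 + ‖linkEmbed L v‖ ^ 2 + ∑ x, ‖su2Quat (g x) - 1‖ ^ 2 ≤ Rin ^ 2 + R ^ 2 + (Fintype.card (Site 3 L) : ℝ) * T ^ 2 := by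
    intro v'' v g hv'' hΩv hWg
    have h1 : ‖linkEmbed L v''‖ ^ 2 ≤ Rin ^ 2 := pow_le_pow_left₀ (norm_nonneg _) hv'' 2
    have h2 : ‖linkEmbed L v‖ ^ 2 ≤ R ^ 2 := pow_le_pow_left₀ (norm_nonneg _) (hΩt v hΩv).2 2
    have h3 : ∑ x, ‖su2Quat (g x) - 1‖ ^ 2 ≤ (Fintype.card (Site 3 L) : ℝ) * T ^ 2 := by
      calc ∑ x, ‖su2Quat (g x) - 1‖ ^ 2 ≤ ∑ _x : Site 3 L, T ^ 2 := Finset.sum_le_sum fun x _ => pow_le_pow_left₀ (norm_nonneg _) ((hWc g hWg).1 x) 2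
        _ = (Fintype.card (Site 3 L) : ℝ) * T ^ 2 := by rw [Finset.sum_const, Finset.card_univ, nsmul_eq_mul]
    linarith
  -- pointwise in the colour: `|F c − ρ c·c_q P| ≤ (2(1+η_c)Q + η_c)·c_qP·ρ c`
  have hpt : ∀ c : SU2, |F c - ρ c * (cq * P (linkEmbed L v'))| ≤ (2 * (1 + ηc) * Q + ηc) * (cq * P (linkEmbed L v')) * ρ c := by
    intro c
    set u'' : GaugeConfig 3 1 SU2 := gaugeTransform (fun _ : Site 3 1 => c⁻¹) u' with hu''
    set v'' : Edge 3 L → Fin 3 → ℝ := colourRotate L (fun _ => c⁻¹) v' with hv''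
    have hFc : F c = fpFibreTransfer L β Ω W (orthoTube L u'' v'') u := by rw [hF]; exact fpFibreTransfer_conj_orthoTube β Ω W c u' u hv'
    have hu''δ : ∀ k : Fin 3, ‖su2Quat (u'' (0, k)) - 1‖ ≤ δ := fun k => by
      rw [hu'']
      show ‖su2Quat (c⁻¹ * u' (0, k) * c⁻¹⁻¹) - 1‖ ≤ δ
      rw [norm_su2Quat_conj_sub_one]; exact hu' k
    have hα : ∀ k : Fin 3, ‖su2Quat (u'' (0, k)) - su2Quat (u (0, k))‖ ≤ δ + δu := fun k => by
      calc ‖su2Quat (u'' (0, k)) - su2Quat (u (0, k))‖ = ‖(su2Quat (u'' (0, k)) - 1) + (1 - su2Quat (u (0, k)))‖ := by congr 1; abel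
        _ ≤ ‖su2Quat (u'' (0, k)) - 1‖ + ‖1 - su2Quat (u (0, k))‖ := norm_add_le _ _
        _ ≤ δ + δu := add_le_add (hu''δ k) (by rw [norm_sub_rev]; exact hu k)
    have hS'' : (L : ℝ) ^ 3 * wilsonAction su2Rep u'' ≤ σ := by rw [hu'', wilsonAction_gaugeTransform]; exact hS'
    have hv''cap : v'' ∈ capBalancedSet L := colourRotate_mem_capBalancedSet L hv'
    have hx'' : linkEmbed L v'' = adL L c⁻¹ (linkEmbed L v') := by rw [hv'']; exact linkEmbed_colourRotate_const c⁻¹ v'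
    have hnx'' : ‖linkEmbed L v''‖ = ‖linkEmbed L v'‖ := by rw [hx'', LinearIsometryEquiv.norm_map]
    have hx''Rin : ‖linkEmbed L v''‖ ≤ Rin := by rw [hnx'']; exact hx'
    have hPx : P (linkEmbed L v'') = P (linkEmbed L v') := by rw [hx'', hPinv]
    have hsx : ‖linkEmbed L v''‖ ^ 2 = s' := by rw [hnx'']
    have hv''T : ∀ (e : Edge 3 L) (a : Fin 3), |v'' e a| ≤ Tc := fun e a => by
      have h := PiLp.norm_apply_le (linkEmbed L v'') (e, a)
      rw [Real.norm_eq_abs, linkEmbed_apply] at h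
      exact h.trans (hx''Rin.trans hRinT)
    -- the moment transport at `(u'', v''; u)`
    have hX : ∀ (v : Edge 3 L → Fin 3 → ℝ) (g : Site 3 L → SU2), Ω (linkEmbed L v) ≠ 0 → W g ≠ 0 →
        |offX L β u'' u v'' v g + diagX L β u'' v'' v g| ≤
            c₀ + c₁ * (‖linkEmbed L v''‖ ^ 2 + ‖linkEmbed L v‖ ^ 2 + ∑ x, ‖su2Quat (g x) - 1‖ ^ 2) +
              c₂ * (‖linkEmbed L v''‖ ^ 2 + ‖linkEmbed L v‖ ^ 2 + ∑ x, ‖su2Quat (g x) - 1‖ ^ 2) ^ 2 ∧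
          c₀ + c₁ * (‖linkEmbed L v''‖ ^ 2 + ‖linkEmbed L v‖ ^ 2 + ∑ x, ‖su2Quat (g x) - 1‖ ^ 2) +
              c₂ * (‖linkEmbed L v''‖ ^ 2 + ‖linkEmbed L v‖ ^ 2 + ∑ x, ‖su2Quat (g x) - 1‖ ^ 2) ^ 2 ≤ 1 := by
      intro v g hΩv hWg
      have hSle := hSsupp v'' v g hx''Rin hΩv hWg
      have hS0 : 0 ≤ ‖linkEmbed L v''‖ ^ 2 + ‖linkEmbed L v‖ ^ 2 + ∑ x, ‖su2Quat (g x) - 1‖ ^ 2 := by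
        have : 0 ≤ ∑ x, ‖su2Quat (g x) - 1‖ ^ 2 := Finset.sum_nonneg fun _ _ => sq_nonneg _
        positivity
      refine ⟨abs_transportExponent_le_quad hβ1 u'' u hv''cap (hΩt v hΩv).1 hu''δ hδ1 hα hα1 hσ hS'' hS (hWc g hWg).2 le_rfl (hSle.trans hS900) hc₀ hc₁ hc₂, ?_⟩
      have hm1 := mul_le_mul_of_nonneg_left hSle hc₁0
      have hm2 := mul_le_mul_of_nonneg_left (pow_le_pow_left₀ hS0 hSle 2) hc₂0
      linarith
    have hmt := fpFibreTransfer_sub_central_le_moments β hΩm hCΩ hΩ0 (R := R) (fun x hx => ?_) hW hCW hW0 u u'' v'' hc₀0 hc₁0 hc₂0 hX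
    swap
    · -- support radius of `Ω` in terms of `x : LinkSpace L`: `x = linkEmbed (e a ↦ x (e, a))`
      have hxe : linkEmbed L (fun e a => x (e, a)) = x := PiLp.ext fun ea => by simp [linkEmbed_apply]
      have h := (hΩt (fun e a => x (e, a)) (by rwa [hxe])).2
      rwa [hxe] at h
    -- the reweighted central transfers at `v''` against `T[Ω,W](v'')`, then the quasimode
    set T1 : ℝ := fpFibreTransfer L β Ω W (orthoTube L 1 v'') 1 with hT1
    have hT10 : 0 ≤ T1 := fpFibreTransfer_nonneg β hΩ0 hW0 _ _
    have ha1 := hwa 1 (Or.inl rfl) v'' hv''cap hx''Rin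
    have ha2 := hwa 2 (Or.inr rfl) v'' hv''cap hx''Rin
    have hb1 := hwb 1 (Or.inl rfl) v'' hv''cap hx''Rin
    have hb2 := hwb 2 (Or.inr rfl) v'' hv''cap hx''Rin
    rw [hsx] at ha1 ha2 hb1 hb2
    have hq := abs_le.mp (hC1 v'' hv''cap hv''T hx''Rin)
    rw [hPx] at hq
    have hT1hi : T1 ≤ (1 + ηc) * (cq * P (linkEmbed L v')) := by rw [hT1]; linarith [hq.2]
    have hρc : transferKernel su2Rep ((L : ℝ) ^ 3 * β) u'' u / transferKernel su2Rep ((L : ℝ) ^ 3 * β) (1 : GaugeConfig 3 1 SU2) 1 = ρ c := by rw [hρ, hB]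
    rw [hρc, hsx] at hmt
    -- `|F c − ρ T1| ≤ 2ρ·Q·T1`
    have hA : (c₀ + c₁ * s' + 3 * c₂ * s' ^ 2) * T1 +
        c₁ * (fpFibreTransfer L β (fun x => Ω x * (‖x‖ ^ 2) ^ 1) W (orthoTube L 1 v'') 1 +
            fpFibreTransfer L β Ω (fun g => W g * (∑ x, ‖su2Quat (g x) - 1‖ ^ 2) ^ 1) (orthoTube L 1 v'') 1) +
        3 * c₂ * (fpFibreTransfer L β (fun x => Ω x * (‖x‖ ^ 2) ^ 2) W (orthoTube L 1 v'') 1 +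
            fpFibreTransfer L β Ω (fun g => W g * (∑ x, ‖su2Quat (g x) - 1‖ ^ 2) ^ 2) (orthoTube L 1 v'') 1) ≤ Q * T1 := by
      rw [hQ]
      have k1 := mul_le_mul_of_nonneg_left (add_le_add ha1 hb1) hc₁0
      have k2 := mul_le_mul_of_nonneg_left (add_le_add ha2 hb2) (by positivity : (0 : ℝ) ≤ 3 * c₂)
      linarith only [k1, k2]
    have h2ρ : 0 ≤ 2 * ρ c := by linarith [hρ0 c]
    have h1 : |F c - ρ c * T1| ≤ 2 * ρ c * (Q * T1) := by
      rw [hFc]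
      exact hmt.trans (mul_le_mul_of_nonneg_left hA h2ρ)
    have h2 : |ρ c * T1 - ρ c * (cq * P (linkEmbed L v'))| ≤ ρ c * (ηc * (cq * P (linkEmbed L v'))) := by
      rw [← mul_sub, abs_mul, abs_of_nonneg (hρ0 c), hT1]
      exact mul_le_mul_of_nonneg_left (abs_le.mpr ⟨by linarith [hq.1], by linarith [hq.2]⟩) (hρ0 c)
    have hcP : 0 ≤ cq * P (linkEmbed L v') := mul_nonneg hcq (hP0 _)
    calc |F c - ρ c * (cq * P (linkEmbed L v'))| = |(F c - ρ c * T1) + (ρ c * T1 - ρ c * (cq * P (linkEmbed L v')))| := by ring_nf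
      _ ≤ |F c - ρ c * T1| + |ρ c * T1 - ρ c * (cq * P (linkEmbed L v'))| := abs_add_le _ _
      _ ≤ 2 * ρ c * (Q * T1) + ρ c * (ηc * (cq * P (linkEmbed L v'))) := add_le_add h1 h2
      _ ≤ 2 * ρ c * (Q * ((1 + ηc) * (cq * P (linkEmbed L v')))) + ρ c * (ηc * (cq * P (linkEmbed L v'))) := by
          have h3 := mul_le_mul_of_nonneg_left (mul_le_mul_of_nonneg_left hT1hi hQ0) h2ρ
          linarith only [h3]
      _ = (2 * (1 + ηc) * Q + ηc) * (cq * P (linkEmbed L v')) * ρ c := by ring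
  -- integrate over the colour
  have hFdef : ∫ c, fpFibreTransfer L β Ω W (gaugeTransform (fun _ : Site 3 L => c⁻¹) (orthoTube L u' v')) u ∂haarProbability SU2 = ∫ c, F c ∂haarProbability SU2 := rfl
  have hG : Integrable (fun c => (2 * (1 + ηc) * Q + ηc) * (cq * P (linkEmbed L v')) * ρ c) (haarProbability SU2) := hρint.const_mul _
  have hdiff : ∫ c, F c ∂haarProbability SU2 - cq * P (linkEmbed L v') * (avgKernel B u' u / transferKernel su2Rep B (1 : GaugeConfig 3 1 SU2) 1) =
      ∫ c, (F c - cq * P (linkEmbed L v') * ρ c) ∂haarProbability SU2 := by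
    rw [← hρI, ← integral_const_mul, integral_sub hFint (hρint.const_mul _)]
  rw [hFdef, hdiff]
  calc |∫ c, (F c - cq * P (linkEmbed L v') * ρ c) ∂haarProbability SU2| ≤ ∫ c, |F c - cq * P (linkEmbed L v') * ρ c| ∂haarProbability SU2 := abs_integral_le_integral_abs
    _ ≤ ∫ c, (2 * (1 + ηc) * Q + ηc) * (cq * P (linkEmbed L v')) * ρ c ∂haarProbability SU2 :=
        integral_mono_of_nonneg (ae_of_all _ fun _ => abs_nonneg _) hG (ae_of_all _ fun c => by
          have h := hpt c; rwa [show ρ c * (cq * P (linkEmbed L v')) = cq * P (linkEmbed L v') * ρ c by ring] at h)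
    _ = (2 * (1 + ηc) * Q + ηc) * (cq * P (linkEmbed L v') * (avgKernel B u' u / transferKernel su2Rep B (1 : GaugeConfig 3 1 SU2) 1)) := by
        rw [integral_const_mul, hρI]; ring

end Summit.QuantumFields.YangMills.Theorems.FemtoTransferGap.TwoLattice.ConstTube

end
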